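import Literature.NumberTheory.LFunctions.Zhang2022.PartIIIConstraints

/-!
# Zhang (2022) Part III: the §2/§18 endgame rows of the cell's constraint file, literally

Trunk T-ANT (NumberTheory/LFunctions). Y. Zhang, *Discrete mean estimates and the Landau–Siegel
zero*, arXiv:2211.02515v1 (2022) [Zhang2022LandauSiegel] — an unrefereed manuscript under
adjudication (cell pub-zhang: audit + repair census; **no claim about Landau–Siegel**). **Nothing in
this file asserts or denies its Theorems 1–2, its Propositions 2.1–2.6, 14.1, or any analytic
lemma.** It is a companion of `PartIIIConstraints`: there the printed numerical closing conditions
of §2/§18 are ONE kernel predicate `PartIIIDesign.EndgameArithmetic` (with a square root and `π`);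
the cell's machine-readable constraint file (`constraints/part3.json`, unit b2b-zhang-dep-3, rows
quoted by id below) records the same conditions as separate division-free, `π`-free rows over the
printed rational literals. This file states that row block verbatim as `PartIIIDesign.EndgameRows`
(one conjunct per row, field names of `PartIIIDesign`; row ↦ conjunct in the docstring) and proves

* `endgameRows_printed`: the printed design satisfies every row (decidable rational arithmetic);
* `endgameArithmetic_of_endgameRows`: the rows imply the kernel predicate — the only non-literal
  steps are `√(xy) < b ⟸ xy < b² ∧ 0 < b` (row III-2.P25a with the SIGN row III-2.P25b) and
  `3.141592 < π` (row III-18.03f rationalises `2·4400/π < cJ` as `2·4400·10⁵ < cJ·314159`);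
  hence `conclusion_of_endgameRows` (the abstract §2 closing, `ConclusionPartIII`);
* `sqrtConjuncts_iff_section2Rows`: the kernel's `0 ≤ q232 ∧ 0 ≤ cJ ∧ √(q232·cJ) < c25` is
  EQUIVALENT to rows III-2.P25a ∧ III-2.P25b;
* `unsignedRows_degenerate`: WITHOUT the sign row the remaining rows admit the degenerate design
  `c25 = −2` (all other fields as printed), at which `EndgameArithmetic` fails — the kernel form of
  the cell's typing note S1-R7 (a) (sweep-1: "the dep rows alone admit thr25 = −10⁶ when the
  thresholds are freed") that motivated row III-2.P25b (part3-v5) and dep-1's I-P2.5a / I-P2.4a.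

All of it is real arithmetic on a parameter record; consistency of constraints, not truth of inputs
((2.32) itself is certified FALSE as printed: `Section18Certificate.not_ineq18sum`,
`Section18AllIota`). Name map JSON ↦ Lean: thr232 ↦ `q232`, thr233 ↦ `cJ`, thr25 ↦ `c25`,
thr24 ↦ `d24`, th824/th98/th182 ↦ `B824/B98/B182`, zf1/zf2/zf3 ↦ `z0/z1/z2`, fslope ↦ `slope`,
w1/w2/w3 ↦ `W1/W2/W3`, main18 ↦ `main18`, crude ↦ `crude`.
-/

noncomputable section

namespace Literature.NumberTheory.LFunctions.Zhang2022

namespace PartIIIDesign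

/-- The §2/§18 endgame rows of the cell constraint file WITHOUT the sign row, literally:
III-2.P25a `thr232*thr233 < thr25**2` (Prop. 2.5 ⇐ (2.32)·(2.33), Cauchy–Schwarz, division-free);
III-2.asm `thr25 < thr24` (the closing contradiction (2.18) + Props. 2.4–2.6);
III-18.02b `th824 + th98 + 2*th182 < thr232` ("it follows from (8.24), (9.8) and (18.2)");
III-18.03b `zf1 < zf2 < zf3 ∧ fslope*(zf2 − zf1) = 1 ∧ fslope*(zf3 − zf2) = 1` (the tent `f̃` of (2.28));
III-18.03c `main18 = fslope²*(zf3 − zf1)` (main contribution `500²·0.004 = 1000`);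
III-18.03d `10*crude = 11*main18` (crude per-`j` bound `1100`);
III-18.03e `4400 = (w1 + w2 + w3)*crude` (residue weights `1/2, 2, 3/2`);
III-18.03f `2*4400*100000 < thr233*314159` ((2.33): `8800/π < 3000`, `π` rationalised downward).
[cite: Zhang2022LandauSiegel, §2 (2.18), (2.28), (2.32)–(2.33), Props. 2.4–2.5, §18 (18.2)–(18.3)] -/
def EndgameRowsUnsigned (p : PartIIIDesign) : Prop :=
  p.q232 * p.cJ < p.c25 ^ 2 ∧
  p.c25 < p.d24 ∧
  p.B824 + p.B98 + 2 * p.B182 < p.q232 ∧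
  (p.z0 < p.z1 ∧ p.z1 < p.z2 ∧ p.slope * (p.z1 - p.z0) = 1 ∧ p.slope * (p.z2 - p.z1) = 1) ∧
  p.main18 = p.slope ^ 2 * (p.z2 - p.z0) ∧
  10 * p.crude = 11 * p.main18 ∧
  4400 = (p.W1 + p.W2 + p.W3) * p.crude ∧
  2 * 4400 * 100000 < p.cJ * 314159

/-- The sign row III-2.P25b `thr25 > 0 and thr232 >= 0 and thr233 >= 0` (part3-v5; dep-1 twins
I-P2.5a `thr25 > 0`, I-P2.4a `thr24 > 0`): `Ξ₂*` (2.19), `Ξ₁` (2.31) and `Ξ_J` (2.33) are sums of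
moduli / mean squares with non-negative weights, so the printed constants bounding them from above
are a positive `b = 2` (Prop. 2.5) and non-negative `0.001`, `3000`.
[cite: Zhang2022LandauSiegel, (2.19), Prop. 2.5, (2.32)–(2.33)] -/
def SignRow (p : PartIIIDesign) : Prop := 0 < p.c25 ∧ 0 ≤ p.q232 ∧ 0 ≤ p.cJ

/-- `EndgameRows p`: the complete §2/§18 endgame row block of the cell constraint file
(part3-v5: III-2.P25a, III-2.P25b, III-2.asm, III-18.02b, III-18.03b–f), literally.
[cite: Zhang2022LandauSiegel, §2 (proof of Thm 1), Prop. 2.5, §18] -/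
def EndgameRows (p : PartIIIDesign) : Prop := p.EndgameRowsUnsigned ∧ p.SignRow

/-- The printed design satisfies every endgame row: `0.001·3000 = 3 < 4`, `2 < 5`,
`6.9955 + 6.9955 − 2·6.9951 = 0.0008 < 0.001`, `500·0.002 = 1`, `1000 = 500²·0.004`,
`11000 = 11000`, `4400 = 4·1100`, `880000000 < 942477000`; `0 < 2`, `0 ≤ 0.001`, `0 ≤ 3000`.
[cite: Zhang2022LandauSiegel, §2, §18] -/
theorem endgameRows_printed : printed.EndgameRows := by
  refine ⟨⟨?_, ?_, ?_, ⟨?_, ?_, ?_, ?_⟩, ?_, ?_, ?_, ?_⟩, ?_, ?_, ?_⟩ <;> norm_num [printed]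

/-- Rows III-2.P25a ∧ III-2.P25b are EQUIVALENT to the kernel's square-root conjuncts
`0 ≤ q232 ∧ 0 ≤ cJ ∧ √(q232·cJ) < c25` of `EndgameArithmetic` (`√x < b ↔ x < b²` for `0 < b`;
and `√x < b` forces `0 < b`). [folklore] -/
theorem sqrtConjuncts_iff_section2Rows (p : PartIIIDesign) :
    (0 ≤ p.q232 ∧ 0 ≤ p.cJ ∧ Real.sqrt (p.q232 * p.cJ) < p.c25) ↔
      (p.q232 * p.cJ < p.c25 ^ 2 ∧ p.SignRow) := by
  constructor
  · rintro ⟨hq, hc, hs⟩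
    have hb : 0 < p.c25 := lt_of_le_of_lt (Real.sqrt_nonneg _) hs
    exact ⟨(Real.sqrt_lt' hb).1 hs, hb, hq, hc⟩
  · rintro ⟨h25a, hb, hq, hc⟩
    exact ⟨hq, hc, (Real.sqrt_lt' hb).2 h25a⟩

/-- With the assembly row, the sign row gives `0 < thr25 < thr24`, i.e. dep-1's I-P2.4a `thr24 > 0`
is a consequence. [folklore] -/
theorem d24_pos_of_endgameRows (p : PartIIIDesign) (h : p.EndgameRows) : 0 < p.c25 ∧ 0 < p.d24 :=
  ⟨h.2.1, h.2.1.trans h.1.2.1⟩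

/-- **The rows imply the kernel predicate.** `√(q232·cJ) < c25` from III-2.P25a + the sign;
`slope²(z2 − z0) = main18 < crude` from III-18.03b/c/d (`slope ≠ 0`, `z0 < z2`, `crude = 1.1·main18`);
`2(W1+W2+W3)·crude = 8800 < cJ·π` from III-18.03e/f and `3.141592 < π` (`Real.pi_gt_d6`).
[folklore] -/
theorem endgameArithmetic_of_endgameRows (p : PartIIIDesign) (h : p.EndgameRows) :
    p.EndgameArithmetic := by
  obtain ⟨⟨h25a, hasm, h182, ⟨hz01, hz12, hs1, _⟩, hmain, hcrude, h4400, h233⟩, hb, hq, hc⟩ := h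
  have hslope : p.slope ≠ 0 := by
    intro h0
    rw [h0, zero_mul] at hs1
    exact zero_ne_one hs1
  have hs2 : 0 < p.slope ^ 2 := lt_of_le_of_ne (sq_nonneg _) (Ne.symm (pow_ne_zero 2 hslope))
  have hmain_pos : 0 < p.main18 := by
    rw [hmain]
    exact mul_pos hs2 (by linarith)
  have hcJ : 0 < p.cJ := by
    by_contra hneg
    have := not_lt.mp hneg
    nlinarith
  have hπ : p.cJ * 3.141592 < p.cJ * Real.pi := mul_lt_mul_of_pos_left Real.pi_gt_d6 hcJ
  refine ⟨hq, hc, (Real.sqrt_lt' hb).2 h25a, hasm, h182, hmain.symm, by linarith, ?_⟩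
  have h8800 : 2 * (p.W1 + p.W2 + p.W3) * p.crude = 8800 := by
    rw [mul_assoc, ← h4400]; norm_num
  rw [h8800]
  nlinarith

/-- **Rows ⇒ the abstract §2 closing** (`ConclusionPartIII`), via `conclusion_of_endgameArithmetic`.
[folklore] -/
theorem conclusion_of_endgameRows (p : PartIIIDesign) (h : p.EndgameRows) : p.ConclusionPartIII :=
  p.conclusion_of_endgameArithmetic (p.endgameArithmetic_of_endgameRows h)

/-- **The sign row is not redundant** (kernel form of the cell's typing note S1-R7 (a)): the design
`c25 = −2`, all other fields as printed, satisfies every UNSIGNED row (`3 < (−2)²`, `−2 < 5`, …)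
but neither the sign row nor `EndgameArithmetic` (`√3 < −2` is false). [folklore] -/
theorem unsignedRows_degenerate :
    ({ printed with c25 := -2 } : PartIIIDesign).EndgameRowsUnsigned ∧
      ¬ ({ printed with c25 := -2 } : PartIIIDesign).SignRow ∧
      ¬ ({ printed with c25 := -2 } : PartIIIDesign).EndgameArithmetic := by
  refine ⟨?_, ?_, ?_⟩
  · refine ⟨?_, ?_, ?_, ⟨?_, ?_, ?_, ?_⟩, ?_, ?_, ?_, ?_⟩ <;> norm_num [printed]
  · rintro ⟨hb, _, _⟩
    norm_num at hb
  · rintro ⟨_, _, hs, _⟩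
    have h0 := Real.sqrt_nonneg (({ printed with c25 := -2 } : PartIIIDesign).q232 *
      ({ printed with c25 := -2 } : PartIIIDesign).cJ)
    have hc : ({ printed with c25 := -2 } : PartIIIDesign).c25 = -2 := rfl
    rw [hc] at hs
    linarith

/-- Hence the unsigned row block does NOT imply the kernel predicate for every design, while the
signed one does (`endgameArithmetic_of_endgameRows`). [folklore] -/
theorem not_forall_endgameArithmetic_of_unsignedRows :
    ¬ ∀ p : PartIIIDesign, p.EndgameRowsUnsigned → p.EndgameArithmetic := fun h =>
  unsignedRows_degenerate.2.2 (h _ unsignedRows_degenerate.1)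

end PartIIIDesign

end Literature.NumberTheory.LFunctions.Zhang2022
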